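import Summits.QuantumFields.BalabanUV.T4Continuum.Spine.NE3.LandauProjectionB8
import Summits.QuantumFields.BalabanUV.T4Continuum.Support.NE3CompetitorNestedFix
import Summits.QuantumFields.BalabanUV.T4Continuum.Support.NE3SpectralCutTorus
import Summits.QuantumFields.BalabanUV.T4Continuum.Support.NE3NestedBlockMeanJensenHS
import Summits.QuantumFields.BalabanUV.T4Continuum.Support.NE3TopRadiusLetters
import Summits.QuantumFields.BalabanUV.T4Continuum.Spine.NE3.SlicB8FlatTangentRep
import HarnessLib

/-!
# T⁴ programme, node NE3 — census R44 (file 1∕2): THE Δ_W-SMOOTH EXACT NESTED-MEAN INTERPOLANT AT A CURVED BACKGROUND, BY SPECTRAL SMOOTHING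
# OF THE NESTED-MEAN FIX AND A NEAR-IDENTITY SOLVE ON THE COARSE TORUS

Cell `pub-balaban-gaps` (track G2, seat `ne3`, unit `pub-balaban-gaps-ne3-g10`; writer prover-pub-balaban-gaps-ne3-g10-0, 2026-08-25), census `ne/NE3.md` §4 R44 ∕ §16.
WHY.  R43 (`SlicePoincareSlicB8Reduction`) reduced THE END's binder `hP` ((P♮) on `slicB8` at a curved background) to ONE shape (CS_W): a competitor with the SAME
nested transported block means, controlled in gradient AND Laplacian energy.  File 2∕2 (`NestedMeanCompetitorCurved`) proves (CS_W) from THIS file's interpolant.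
THE CONSTRUCTION (`exists_smooth_nestedMean_interpolant`).  Data: a skew `N`-periodic coarse field `q`.  `F(p) := nfixW … 0 p` is leaf-01-g6's NESTED-MEAN FIX of the
zero field towards `p` (`NE3CompetitorNestedFix`: dressed tent bump, `bmeanIterW (F p) = p` EXACTLY, energy `Σ‖D_W F p‖² ≤ 2Φ·Σ‖p‖²`,
`Φ = d·M^d·(1∕M + 2(d−1)(M−1)x)²·(2∕tentMean)²`); `cutLow ∕ cutHigh` is the spectral cut of `D_W†D_W` at `ϑ := 8Φ·card n∕M^d` (`NE3SpectralCutTorus`).  The coarse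
operator `E p := bmeanIterW (cutHigh ϑ (F p))` is a CONTRACTION, `Σ nhs (E p) ≤ ¼Σ nhs p` (Jensen `NE3NestedBlockMeanJensenHS` ∘ «no small divisor above ϑ» ∘ the fix's
energy), so the owner's near-scalar solve (`NE3NearScalarSolve.existsUnique_solve_norm` on `Sec d n N`) gives `p` with `p − E p = q`, `Σ nhs p ≤ 4Σ nhs q`; then
`v₀ := cutLow ϑ (F p)` has `bmeanIterW v₀ = q` EXACTLY, `Σ nhs (D_Wv₀) ≤ 8Φ·card n·Σ nhs q` and `Σ nhs (Δ_Wv₀) ≤ ϑ·8Φ·card n·Σ nhs q` («small Laplacian below ϑ»);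
its skew part `v := ½(v₀ − v₀ᴴ)` keeps all three.  No C¹ profile, no line averaging, no curvature-gradient radius; every constant k-FREE.
CONTENT (0 sorry, no `def`; [folklore]): §1 helpers; §2 **`exists_smooth_nestedMean_interpolant`**.
HONEST FRAMING.  Linear algebra over landed kinematics at one background of the class; nothing of Bałaban's asserted; (P♮) on `slicB8`, `PairLandauGaugeB8Avg`,
(H3ˢᵘᵖ), the covariant root and **NE3 are NOT proved** here; spine PROVED 0∕9; finite T⁴ rung (B)+1 — NOT continuum YM on ℝ⁴, NOT infinite volume, NOT mass gap,
NOT Clay.  PLACEMENT: `Summits/QuantumFields/BalabanUV/T4Continuum/Spine/NE3/`; imports accepted modules only; moves nothing.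
-/

set_option autoImplicit false

open scoped BigOperators Matrix Matrix.Norms.L2Operator
open Finset

namespace Summit.QuantumFields.BalabanUV.T4Continuum.NE3.NestedMeanSmoothInterpolant

open Literature.MathematicalPhysics.QuantumFieldTheory.Balaban1983to89
open B7Prop1Explicit B7Prop2Explicit MatrixNorms
open T4AveragingDeficitWall (IsUnitaryCfg IsSkewDir SmallField Ad)
open T4AveragingDeficitWallBoundary (IsPeriodicCfg periodBox mem_periodBox)
open AveragingDeficitPeriodicCounting (IsPeriodicDir)
open AveragingDeficitNearIdentity (Ad_add Ad_real_smul)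
open AveragingDeficitTwoLevelPrep (prop1Radius)
open AveragingDeficitMultiLevelPrep (tower LevelSmall)
open AveragingDeficitHSInner (nhsNormSq_smul)
open SpreadLift (loopRad)
open BlockAveragePushDirGauge (gaugeDir isPeriodicDir_gaugeDir)
open NE3CovariantCalculus (hsR nhsNormSq_sub_le nhsNormSq_neg)
open NE3CovariantWeitzenbock (covDiv)
open NE3CovariantBlockMean (bmeanIterW)
open NE3FrameFreeSliceW (bmeanIterW_add bmeanIterW_smul bmeanIterW_zero')
open NE3CurvedProjectedLandau (tower_eq_pow_mul)
open NE3NestedMeanBlockOperator (tentMean tentMean_pos inv_le_tentMean star_bmeanIterW bmeanIterW_add_period')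
open NE3CompetitorNestedFix (nfixW nfixCoef bmeanIterW_nfixW nfixW_add_period sum_normSq_gaugeDir_nfixW_le)
open NE3TopRadiusLetters (E_le_half_of_levelSmall)
open NE3NearScalarSolve (existsUnique_solve_norm)
open NE3HilbertSchmidtTorus (Sec extS resS extS_add extS_smul extS_resS extS_add_period norm_sq_resS norm_sq_eq_sum_extS resS_add)
open NE3CovariantAdjointTorus (gaugeDir_neg_conjTranspose covDiv_neg_conjTranspose)
open NE3SpectralCutTorus (cutLow cutHigh cutLow_add_period cutHigh_add_period cutLow_add_cutHigh cutHigh_add_fun cutHigh_smul_fun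
  sum_nhsNormSq_cutHigh_le sum_nhsNormSq_covDiv_gaugeDir_cutLow_le sum_nhsNormSq_gaugeDir_cutLow_le)
open NE3NestedBlockMeanJensenHS (sum_nhsNormSq_bmeanIterW_le_one)
open NE3DressedBlockField (dressW)
open NE3TentBump (bump)
open NE3.PairLandauB8 (avgKernelGauges mem_avgKernelGauges_iff covLapSite)
open NE3.LandauProjectionB8 (covDiv_gaugeDir_eq_covLapSite covLapSite_add)
open NE3.SlicB8FlatTangentRep (half_sub_ct_mem nhsNormSq_half_sub_ct_le half_sub_ct_of_skew)

noncomputable section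

variable {d : ℕ} {n : Type*} [Fintype n] [DecidableEq n]

/-! ## §1 Helpers -/

/-- `covLapSite W (t • f) = t • covLapSite W f` (real scalars). [folklore] -/
theorem covLapSite_smul_fun (W : Site d → Fin d → (Matrix n n ℂ)ˣ) (t : ℝ) (f : Site d → Matrix n n ℂ) (y : Site d) :
    covLapSite W (fun z => t • f z) y = t • covLapSite W f y := by
  rw [← covDiv_gaugeDir_eq_covLapSite, ← covDiv_gaugeDir_eq_covLapSite]
  have h : gaugeDir W (fun z => t • f z) = fun z κ => t • gaugeDir W f z κ := by
    funext z κ; exact NE3HilbertSchmidtTorus.gaugeDir_smul_fun W t f z κ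
  rw [h, NE3HilbertSchmidtTorus.covDiv_smul_fun]

/-- `covLapSite W (f + g) y = covLapSite W f y + covLapSite W g y` (lambda form). [folklore] -/
theorem covLapSite_add_fun (W : Site d → Fin d → (Matrix n n ℂ)ˣ) (f g : Site d → Matrix n n ℂ) (y : Site d) :
    covLapSite W (fun z => f z + g z) y = covLapSite W f y + covLapSite W g y := by
  have h : (fun z => f z + g z) = f + g := rfl
  rw [h, covLapSite_add, Pi.add_apply]

/-- `covLapSite W (−fᴴ) = −(covLapSite W f)ᴴ` at a unitary background. [folklore] -/
theorem covLapSite_neg_conjTranspose {W : Site d → Fin d → (Matrix n n ℂ)ˣ} (hWu : IsUnitaryCfg W) (f : Site d → Matrix n n ℂ) (y : Site d) :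
    covLapSite W (fun z => -(f z)ᴴ) y = -(covLapSite W f y)ᴴ := by
  rw [← covDiv_gaugeDir_eq_covLapSite, ← covDiv_gaugeDir_eq_covLapSite]
  have h : gaugeDir W (fun z => -(f z)ᴴ) = fun z κ => -(gaugeDir W f z κ)ᴴ := by
    funext z κ; exact gaugeDir_neg_conjTranspose hWu f z κ
  rw [h, covDiv_neg_conjTranspose hWu]

/-- `bmeanIterW` in lambda forms. [folklore] -/
theorem bmeanIterW_add_fun (L j : ℕ) (W : Site d → Fin d → (Matrix n n ℂ)ˣ) (A B : Site d → Matrix n n ℂ) (z : Site d) :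
    bmeanIterW L j W (fun y => A y + B y) z = bmeanIterW L j W A z + bmeanIterW L j W B z := by
  have h : (fun y => A y + B y) = A + B := rfl
  rw [h, bmeanIterW_add, Pi.add_apply]

/-- `bmeanIterW` in lambda forms (scalars). [folklore] -/
theorem bmeanIterW_smul_fun (L j : ℕ) (W : Site d → Fin d → (Matrix n n ℂ)ˣ) (t : ℝ) (A : Site d → Matrix n n ℂ) (z : Site d) :
    bmeanIterW L j W (fun y => t • A y) z = t • bmeanIterW L j W A z := by
  have h : (fun y => t • A y) = t • A := rfl
  rw [h, bmeanIterW_smul, Pi.smul_apply]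

/-- `bmeanIterW (fᴴ) = (bmeanIterW f)ᴴ` at a unitary background of the class. [folklore] -/
theorem bmeanIterW_conjTranspose [Nonempty n] {L : ℕ} (hL : 1 ≤ L) (j : ℕ) {W : Site d → Fin d → (Matrix n n ℂ)ˣ} {x : ℝ}
    (hWu : IsUnitaryCfg W) (hx : 0 ≤ x) (hsm : LevelSmall d L j x) (hWx : SmallField W x) (F : Site d → Matrix n n ℂ) (z : Site d) :
    bmeanIterW L (j + 1) W (fun y => (F y)ᴴ) z = (bmeanIterW L (j + 1) W F z)ᴴ := by
  have h := star_bmeanIterW hL j hWu hx hsm hWx F z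
  simp only [Matrix.star_eq_conjTranspose] at h
  exact h.symm

/-! ## §2 The Δ_W-smooth exact nested-mean interpolant -/

set_option maxHeartbeats 1600000 in
/-- **THE Δ_W-SMOOTH EXACT NESTED-MEAN INTERPOLANT** (`1 ≤ d`, `2 ≤ L`, `1 ≤ N`; unitary `W` of period `N·L^{j+1}` in the tower's small-field class — `0 ≤ x`,
`LevelSmall d L j x`, `SmallField W x`; `M = L^{j+1}`, `Φ = d·M^d·(1∕M + 2((d−1)(M−1)x))²·(2∕tentMean d M)²`, `ϑ = 8Φ·card n∕M^d`): every skew `N`-periodic coarse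
field `q` has a skew `(N·L^{j+1})`-periodic fine field `v` with `bmeanIterW L (j+1) W v = q` EXACTLY,
`Σ_{periodBox} Σ_κ nhs (gaugeDir W v) ≤ 8Φ·card n·Σ_{periodBox N} nhs q` and `Σ_{periodBox} nhs (covLapSite W v) ≤ ϑ·(8Φ·card n)·Σ_{periodBox N} nhs q`. [folklore] -/
theorem exists_smooth_nestedMean_interpolant [Nonempty n] (hd : 1 ≤ d) {L N : ℕ} (hL : 2 ≤ L) (hN : 1 ≤ N) (j : ℕ)
    {W : Site d → Fin d → (Matrix n n ℂ)ˣ} {x : ℝ} (hWu : IsUnitaryCfg W) (hWP : IsPeriodicCfg W ((N * L ^ (j + 1) : ℕ) : ℤ))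
    (hx : 0 ≤ x) (hsm : LevelSmall d L j x) (hWx : SmallField W x)
    {q : Site d → Matrix n n ℂ} (hqs : ∀ z, q z ∈ skewAdjoint (Matrix n n ℂ)) (hqP : ∀ (z : Site d) (i : Fin d), q (z + (N : ℤ) • e i) = q z) :
    ∃ v : Site d → Matrix n n ℂ, (∀ y, v y ∈ skewAdjoint (Matrix n n ℂ)) ∧
      (∀ (y : Site d) (i : Fin d), v (y + ((N * L ^ (j + 1) : ℕ) : ℤ) • e i) = v y) ∧
      bmeanIterW L (j + 1) W v = q ∧
      ∑ y ∈ periodBox (d := d) (N * L ^ (j + 1)), ∑ κ : Fin d, nhsNormSq (gaugeDir W v y κ)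
        ≤ (8 * ((d : ℝ) * (((L ^ (j + 1) : ℕ) : ℝ)) ^ d * (1 / (((L ^ (j + 1) : ℕ) : ℝ)) + 2 * (((d : ℝ) - 1) * ((((L ^ (j + 1) : ℕ) : ℝ)) - 1) * x)) ^ 2
              * (2 / tentMean d (L ^ (j + 1))) ^ 2) * (Fintype.card n : ℝ))
            * ∑ z ∈ periodBox (d := d) N, nhsNormSq (q z) ∧
      ∑ y ∈ periodBox (d := d) (N * L ^ (j + 1)), nhsNormSq (covLapSite W v y)
        ≤ (8 * ((d : ℝ) * (((L ^ (j + 1) : ℕ) : ℝ)) ^ d * (1 / (((L ^ (j + 1) : ℕ) : ℝ)) + 2 * (((d : ℝ) - 1) * ((((L ^ (j + 1) : ℕ) : ℝ)) - 1) * x)) ^ 2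
              * (2 / tentMean d (L ^ (j + 1))) ^ 2) * (Fintype.card n : ℝ) / (((L ^ (j + 1) : ℕ) : ℝ)) ^ d)
          * ((8 * ((d : ℝ) * (((L ^ (j + 1) : ℕ) : ℝ)) ^ d * (1 / (((L ^ (j + 1) : ℕ) : ℝ)) + 2 * (((d : ℝ) - 1) * ((((L ^ (j + 1) : ℕ) : ℝ)) - 1) * x)) ^ 2
              * (2 / tentMean d (L ^ (j + 1))) ^ 2) * (Fintype.card n : ℝ))
            * ∑ z ∈ periodBox (d := d) N, nhsNormSq (q z)) := by
  have hL1 : 1 ≤ L := by omega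
  have hE := E_le_half_of_levelSmall (d := d) hL1 j hx hsm
  haveI : NeZero N := ⟨by omega⟩
  have hM1 : 1 ≤ L ^ (j + 1) := Nat.one_le_pow _ _ hL1
  have hM2 : 2 ≤ L ^ (j + 1) := le_trans hL (Nat.le_self_pow (Nat.succ_ne_zero j) L)
  have hMpos : (0 : ℝ) < ((L ^ (j + 1) : ℕ) : ℝ) := by exact_mod_cast (show 0 < L ^ (j + 1) by omega)
  have hMR : ((L ^ (j + 1) : ℕ) : ℝ) = (L : ℝ) ^ (j + 1) := by push_cast; rfl
  have hMd : (0 : ℝ) < (((L ^ (j + 1) : ℕ) : ℝ)) ^ d := by positivity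
  have hP1 : 1 ≤ N * L ^ (j + 1) := Nat.one_le_iff_ne_zero.mpr (Nat.mul_ne_zero (by omega) (by omega))
  haveI : NeZero (N * L ^ (j + 1)) := ⟨by omega⟩
  have htower : tower L N (j + 1) = L ^ (j + 1) * N := by rw [tower_eq_pow_mul]
  have hNM : N * L ^ (j + 1) = L ^ (j + 1) * N := Nat.mul_comm _ _
  have hWP_T : IsPeriodicCfg W ((tower L N (j + 1) : ℕ) : ℤ) := by rw [htower, ← hNM]; exact hWP
  have ht0 : 0 < tentMean d (L ^ (j + 1)) := tentMean_pos hM2 d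
  have hcn : (1 : ℝ) ≤ (Fintype.card n : ℝ) := by exact_mod_cast Fintype.card_pos
  have hd1 : (1 : ℝ) ≤ d := by exact_mod_cast hd
  obtain ⟨Φ, hΦ⟩ : ∃ Φ : ℝ, Φ = (d : ℝ) * (((L ^ (j + 1) : ℕ) : ℝ)) ^ d
      * (1 / (((L ^ (j + 1) : ℕ) : ℝ)) + 2 * (((d : ℝ) - 1) * ((((L ^ (j + 1) : ℕ) : ℝ)) - 1) * x)) ^ 2 * (2 / tentMean d (L ^ (j + 1))) ^ 2 := ⟨_, rfl⟩
  have hΦpos : 0 < Φ := by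
    rw [hΦ]
    have hdm : (0 : ℝ) ≤ (d : ℝ) - 1 := by linarith
    have hM1r : (1 : ℝ) ≤ ((L ^ (j + 1) : ℕ) : ℝ) := by exact_mod_cast hM1
    have h2 : 0 ≤ 2 * (((d : ℝ) - 1) * ((((L ^ (j + 1) : ℕ) : ℝ)) - 1) * x) := by
      have := mul_nonneg (mul_nonneg hdm (by linarith : (0 : ℝ) ≤ (((L ^ (j + 1) : ℕ) : ℝ)) - 1)) hx; linarith
    have h1 : 0 < 1 / (((L ^ (j + 1) : ℕ) : ℝ)) + 2 * (((d : ℝ) - 1) * ((((L ^ (j + 1) : ℕ) : ℝ)) - 1) * x) := by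
      have : 0 < 1 / (((L ^ (j + 1) : ℕ) : ℝ)) := by positivity
      linarith
    have hd0 : (0 : ℝ) < d := by linarith
    positivity
  obtain ⟨Cg, hCg⟩ : ∃ C : ℝ, C = 8 * Φ * (Fintype.card n : ℝ) := ⟨_, rfl⟩
  have hCgpos : 0 < Cg := by rw [hCg]; positivity
  obtain ⟨ϑ, hϑ⟩ : ∃ r : ℝ, r = 8 * Φ * (Fintype.card n : ℝ) / (((L ^ (j + 1) : ℕ) : ℝ)) ^ d := ⟨_, rfl⟩
  have hϑpos : 0 < ϑ := by rw [hϑ]; positivity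
  have hϑCg : ϑ = Cg / (((L ^ (j + 1) : ℕ) : ℝ)) ^ d := by rw [hϑ, hCg]
  obtain ⟨F, hF⟩ : ∃ F : (Site d → Matrix n n ℂ) → (Site d → Matrix n n ℂ),
      F = fun p => nfixW hL j hWu hx hsm hWx hE (0 : Site d → Matrix n n ℂ) p := ⟨_, rfl⟩
  have hFform : ∀ p : Site d → Matrix n n ℂ,
      F p = fun y => dressW (L ^ (j + 1)) W (bump (L ^ (j + 1)) (nfixCoef hL j hWu hx hsm hWx hE p)) y := by
    intro p; rw [hF]; funext y
    simp only [nfixW, Pi.zero_apply, zero_add, bmeanIterW_zero', sub_zero]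
  have hcoef_add : ∀ p₁ p₂ : Site d → Matrix n n ℂ,
      nfixCoef hL j hWu hx hsm hWx hE (fun z => p₁ z + p₂ z) = fun z => nfixCoef hL j hWu hx hsm hWx hE p₁ z + nfixCoef hL j hWu hx hsm hWx hE p₂ z := by
    intro p₁ p₂; funext z; simp only [nfixCoef, map_add]
  have hcoef_smul : ∀ (t : ℝ) (p : Site d → Matrix n n ℂ),
      nfixCoef hL j hWu hx hsm hWx hE (fun z => t • p z) = fun z => t • nfixCoef hL j hWu hx hsm hWx hE p z := by
    intro t p; funext z; simp only [nfixCoef, map_smul]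
  have hF_add : ∀ p₁ p₂ : Site d → Matrix n n ℂ, F (fun z => p₁ z + p₂ z) = fun y => F p₁ y + F p₂ y := by
    intro p₁ p₂
    rw [hFform, hFform, hFform, hcoef_add]
    funext y
    simp only [dressW, bump, smul_add, Ad_add]
  have hF_smul : ∀ (t : ℝ) (p : Site d → Matrix n n ℂ), F (fun z => t • p z) = fun y => t • F p y := by
    intro t p
    rw [hFform, hFform, hcoef_smul]
    funext y
    simp only [dressW, bump, Ad_real_smul, smul_smul]
    rw [mul_comm]
  have hF_mean : ∀ (p : Site d → Matrix n n ℂ) (z : Site d), bmeanIterW L (j + 1) W (F p) z = p z := by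
    intro p z; rw [hF]; exact bmeanIterW_nfixW hL j hWu hx hsm hWx hE 0 p z
  have hF_per : ∀ p : Site d → Matrix n n ℂ, (∀ (z : Site d) (i : Fin d), p (z + (N : ℤ) • e i) = p z) →
      ∀ (y : Site d) (i : Fin d), F p (y + ((N * L ^ (j + 1) : ℕ) : ℤ) • e i) = F p y := by
    intro p hp y i
    have h := nfixW_add_period hL j hWu hx hsm hWx hE (N := N) hWP_T (F₀ := 0) (fun _ _ => rfl) hp y i
    rw [htower, ← hNM] at h
    rw [hF]; exact h
  have hF_energy : ∀ p : Site d → Matrix n n ℂ,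
      ∑ y ∈ periodBox (d := d) (L ^ (j + 1) * N), ∑ α : Fin d, ‖gaugeDir W (F p) y α‖ ^ 2
        ≤ 2 * Φ * ∑ z ∈ periodBox (d := d) N, ‖p z‖ ^ 2 := by
    intro p
    have h := sum_normSq_gaugeDir_nfixW_le hL j hWu hx hsm hWx hE N hx hWx (0 : Site d → Matrix n n ℂ) p
    have h0 : ∀ (y : Site d) (α : Fin d), gaugeDir W (0 : Site d → Matrix n n ℂ) y α = 0 := by
      intro y α; simp [gaugeDir]
    simp only [h0, norm_zero, ne_eq, OfNat.ofNat_ne_zero, not_false_eq_true, zero_pow, sum_const_zero, mul_zero, zero_add,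
      bmeanIterW_zero', Pi.zero_apply, sub_zero] at h
    rw [hF]
    calc _ ≤ _ := h
      _ = 2 * Φ * ∑ z ∈ periodBox (d := d) N, ‖p z‖ ^ 2 := by rw [hΦ]; ring
  have hF_energy' : ∀ p : Site d → Matrix n n ℂ,
      ∑ y ∈ periodBox (d := d) (N * L ^ (j + 1)), ∑ α : Fin d, nhsNormSq (gaugeDir W (F p) y α)
        ≤ 2 * Φ * (Fintype.card n : ℝ) * ∑ z ∈ periodBox (d := d) N, nhsNormSq (p z) := by
    intro p
    have h1 : ∑ y ∈ periodBox (d := d) (N * L ^ (j + 1)), ∑ α : Fin d, nhsNormSq (gaugeDir W (F p) y α)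
        ≤ ∑ y ∈ periodBox (d := d) (L ^ (j + 1) * N), ∑ α : Fin d, ‖gaugeDir W (F p) y α‖ ^ 2 := by
      rw [hNM]; exact sum_le_sum fun y _ => sum_le_sum fun α _ => nhsNormSq_le_opNorm_sq _
    have h2 : ∑ z ∈ periodBox (d := d) N, ‖p z‖ ^ 2 ≤ (Fintype.card n : ℝ) * ∑ z ∈ periodBox (d := d) N, nhsNormSq (p z) := by
      rw [mul_sum]; exact sum_le_sum fun z _ => opNorm_sq_le_card_mul_nhsNormSq _
    calc _ ≤ _ := h1
      _ ≤ 2 * Φ * ∑ z ∈ periodBox (d := d) N, ‖p z‖ ^ 2 := hF_energy p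
      _ ≤ 2 * Φ * ((Fintype.card n : ℝ) * ∑ z ∈ periodBox (d := d) N, nhsNormSq (p z)) := mul_le_mul_of_nonneg_left h2 (by positivity)
      _ = _ := by ring
  obtain ⟨E, hEdef⟩ : ∃ E : (Site d → Matrix n n ℂ) → (Site d → Matrix n n ℂ),
      E = fun p z => bmeanIterW L (j + 1) W (cutHigh W (N * L ^ (j + 1)) ϑ (F p)) z := ⟨_, rfl⟩
  have hE_add : ∀ p₁ p₂ : Site d → Matrix n n ℂ, E (fun z => p₁ z + p₂ z) = fun z => E p₁ z + E p₂ z := by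
    intro p₁ p₂; rw [hEdef]; funext z
    simp only [hF_add]
    have h : cutHigh W (N * L ^ (j + 1)) ϑ (fun y => F p₁ y + F p₂ y)
        = fun y => cutHigh W (N * L ^ (j + 1)) ϑ (F p₁) y + cutHigh W (N * L ^ (j + 1)) ϑ (F p₂) y := by
      funext y; exact cutHigh_add_fun W _ ϑ (F p₁) (F p₂) y
    rw [h, bmeanIterW_add_fun]
  have hE_smul : ∀ (t : ℝ) (p : Site d → Matrix n n ℂ), E (fun z => t • p z) = fun z => t • E p z := by
    intro t p; rw [hEdef]; funext z
    simp only [hF_smul]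
    have h : cutHigh W (N * L ^ (j + 1)) ϑ (fun y => t • F p y) = fun y => t • cutHigh W (N * L ^ (j + 1)) ϑ (F p) y := by
      funext y; exact cutHigh_smul_fun W _ ϑ t (F p) y
    rw [h, bmeanIterW_smul_fun]
  have hE_per : ∀ p : Site d → Matrix n n ℂ, (∀ (z : Site d) (i : Fin d), p (z + (N : ℤ) • e i) = p z) →
      ∀ (z : Site d) (i : Fin d), E p (z + (N : ℤ) • e i) = E p z := by
    intro p hp z i; rw [hEdef]
    have hcP : ∀ (y : Site d) (i : Fin d), cutHigh W (N * L ^ (j + 1)) ϑ (F p) (y + ((tower L N (j + 1) : ℕ) : ℤ) • e i)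
        = cutHigh W (N * L ^ (j + 1)) ϑ (F p) y := by
      intro y i; rw [htower, ← hNM]; exact cutHigh_add_period W _ ϑ (F p) y i
    exact bmeanIterW_add_period' j hWP_T hcP z i
  have hE_contr : ∀ p : Site d → Matrix n n ℂ, (∀ (z : Site d) (i : Fin d), p (z + (N : ℤ) • e i) = p z) →
      ∑ z ∈ periodBox (d := d) N, nhsNormSq (E p z) ≤ (1 / 4) * ∑ z ∈ periodBox (d := d) N, nhsNormSq (p z) := by
    intro p hp
    have hwP : ∀ (y : Site d) (τ : Fin d), F p (y + ((N * L ^ (j + 1) : ℕ) : ℤ) • e τ) = F p y := hF_per p hp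
    have hJ := sum_nhsNormSq_bmeanIterW_le_one hL1 j hWu hx hsm hWx (cutHigh W (N * L ^ (j + 1)) ϑ (F p)) N
    rw [← mul_sum, ← hMR, ← hNM] at hJ
    have hC := sum_nhsNormSq_cutHigh_le W (N * L ^ (j + 1)) hϑpos hwP
    have hG := hF_energy' p
    have hchain : (((L ^ (j + 1) : ℕ) : ℝ)) ^ d * ∑ z ∈ periodBox (d := d) N, nhsNormSq (E p z)
        ≤ ϑ⁻¹ * (2 * Φ * (Fintype.card n : ℝ) * ∑ z ∈ periodBox (d := d) N, nhsNormSq (p z)) := by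
      have hE' : ∑ z ∈ periodBox (d := d) N, nhsNormSq (E p z)
          = ∑ z ∈ periodBox (d := d) N, nhsNormSq (bmeanIterW L (j + 1) W (cutHigh W (N * L ^ (j + 1)) ϑ (F p)) z) := by rw [hEdef]
      rw [hE']
      exact hJ.trans (hC.trans (mul_le_mul_of_nonneg_left hG (by positivity)))
    have hkey : ϑ⁻¹ * (2 * Φ * (Fintype.card n : ℝ)) = (1 / 4) * (((L ^ (j + 1) : ℕ) : ℝ)) ^ d := by
      rw [hϑ]; field_simp; ring
    have h2 : (((L ^ (j + 1) : ℕ) : ℝ)) ^ d * ∑ z ∈ periodBox (d := d) N, nhsNormSq (E p z)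
        ≤ (((L ^ (j + 1) : ℕ) : ℝ)) ^ d * ((1 / 4) * ∑ z ∈ periodBox (d := d) N, nhsNormSq (p z)) := by
      calc _ ≤ ϑ⁻¹ * (2 * Φ * (Fintype.card n : ℝ) * ∑ z ∈ periodBox (d := d) N, nhsNormSq (p z)) := hchain
        _ = (ϑ⁻¹ * (2 * Φ * (Fintype.card n : ℝ))) * ∑ z ∈ periodBox (d := d) N, nhsNormSq (p z) := by ring
        _ = _ := by rw [hkey]; ring
    exact le_of_mul_le_mul_left h2 hMd
  let Kc : Sec d n N →ₗ[ℝ] Sec d n N :=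
    { toFun := fun a => -resS N (E (extS N a))
      map_add' := fun a b => by
        have h : extS N (a + b) = fun z => extS N a z + extS N b z := by funext z; exact extS_add N a b z
        rw [h, hE_add, resS_add, neg_add]
      map_smul' := fun t a => by
        have h : extS N (t • a) = fun z => t • extS N a z := by funext z; exact extS_smul N t a z
        rw [h, hE_smul]
        have h2 : resS (d := d) N (fun z => t • E (extS N a) z) = t • resS N (E (extS N a)) := by ext s : 1; rfl
        rw [h2, RingHom.id_apply, smul_neg] }
  have hKc_apply : ∀ a : Sec d n N, Kc a = -resS N (E (extS N a)) := fun a => rfl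
  have hK : ∀ a : Sec d n N, ‖Kc a‖ ≤ (1 / 2) * ‖a‖ := by
    intro a
    have hp : ∀ (z : Site d) (i : Fin d), extS N a (z + (N : ℤ) • e i) = extS N a z := fun z i => extS_add_period N a z i
    have hsq : ‖Kc a‖ ^ 2 ≤ ((1 / 2) * ‖a‖) ^ 2 := by
      rw [hKc_apply, norm_neg, norm_sq_resS, mul_pow, norm_sq_eq_sum_extS]
      have := hE_contr (extS N a) hp
      nlinarith [this]
    exact (pow_le_pow_iff_left₀ (norm_nonneg _) (by positivity) two_ne_zero).mp hsq
  obtain ⟨a, ⟨ha_eq, ha_bd⟩, -⟩ := existsUnique_solve_norm Kc zero_le_one (by norm_num : (1 / 2 : ℝ) < 1) hK (resS N q)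
  rw [one_smul] at ha_eq
  obtain ⟨p, hpdef⟩ : ∃ p : Site d → Matrix n n ℂ, p = extS N a := ⟨_, rfl⟩
  have hpP : ∀ (z : Site d) (i : Fin d), p (z + (N : ℤ) • e i) = p z := fun z i => by rw [hpdef]; exact extS_add_period N a z i
  have hp_eq : ∀ z : Site d, p z - E p z = q z := by
    intro z
    have h : extS N (a + Kc a) z = extS N (resS N q) z := by rw [ha_eq]
    rw [extS_add, hKc_apply, extS_resS N hqP] at h
    have h2 : extS N (-resS N (E (extS N a))) z = -(E (extS N a) z) := by
      have : extS N (-resS N (E (extS N a))) z = -(extS N (resS N (E (extS N a))) z) := rfl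
      rw [this, extS_resS N (hE_per (extS N a) (fun z i => extS_add_period N a z i))]
    rw [h2] at h
    rw [hpdef, sub_eq_add_neg]; exact h
  have hp_bd : ∑ z ∈ periodBox (d := d) N, nhsNormSq (p z) ≤ 4 * ∑ z ∈ periodBox (d := d) N, nhsNormSq (q z) := by
    have h1 : ∑ z ∈ periodBox (d := d) N, nhsNormSq (p z) = ‖a‖ ^ 2 := by rw [hpdef, norm_sq_eq_sum_extS]
    have h2 : ∑ z ∈ periodBox (d := d) N, nhsNormSq (q z) = ‖resS (d := d) N q‖ ^ 2 := by rw [norm_sq_resS]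
    rw [h1, h2]
    have h3 : ‖a‖ ≤ 2 * ‖resS (d := d) N q‖ := by
      have : ‖resS (d := d) N q‖ / (1 - 1 / 2) = 2 * ‖resS (d := d) N q‖ := by ring
      rw [this] at ha_bd; exact ha_bd
    nlinarith [norm_nonneg a, norm_nonneg (resS (d := d) N q)]
  have hwP : ∀ (y : Site d) (τ : Fin d), F p (y + ((N * L ^ (j + 1) : ℕ) : ℤ) • e τ) = F p y := hF_per p hpP
  obtain ⟨v₀, hv₀⟩ : ∃ v : Site d → Matrix n n ℂ, v = cutLow W (N * L ^ (j + 1)) ϑ (F p) := ⟨_, rfl⟩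
  have hv₀P : ∀ (y : Site d) (i : Fin d), v₀ (y + ((N * L ^ (j + 1) : ℕ) : ℤ) • e i) = v₀ y := by
    intro y i; rw [hv₀]; exact cutLow_add_period W _ ϑ (F p) y i
  have hv₀_mean : ∀ z : Site d, bmeanIterW L (j + 1) W v₀ z = q z := by
    intro z
    have hsplit : v₀ = fun y => F p y + (-1 : ℝ) • cutHigh W (N * L ^ (j + 1)) ϑ (F p) y := by
      funext y; rw [hv₀, neg_one_smul, ← cutLow_add_cutHigh W (N * L ^ (j + 1)) ϑ hwP y]; abel
    rw [hsplit, bmeanIterW_add_fun, bmeanIterW_smul_fun, hF_mean, neg_one_smul, ← sub_eq_add_neg]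
    have hEz : E p z = bmeanIterW L (j + 1) W (cutHigh W (N * L ^ (j + 1)) ϑ (F p)) z := by rw [hEdef]
    rw [← hEz]; exact hp_eq z
  have hv₀_grad : ∑ y ∈ periodBox (d := d) (N * L ^ (j + 1)), ∑ κ : Fin d, nhsNormSq (gaugeDir W v₀ y κ)
      ≤ Cg * ∑ z ∈ periodBox (d := d) N, nhsNormSq (q z) := by
    rw [hv₀]
    calc _ ≤ ∑ y ∈ periodBox (d := d) (N * L ^ (j + 1)), ∑ κ : Fin d, nhsNormSq (gaugeDir W (F p) y κ) :=
          sum_nhsNormSq_gaugeDir_cutLow_le W _ ϑ hwP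
      _ ≤ 2 * Φ * (Fintype.card n : ℝ) * ∑ z ∈ periodBox (d := d) N, nhsNormSq (p z) := hF_energy' p
      _ ≤ 2 * Φ * (Fintype.card n : ℝ) * (4 * ∑ z ∈ periodBox (d := d) N, nhsNormSq (q z)) :=
          mul_le_mul_of_nonneg_left hp_bd (by positivity)
      _ = Cg * ∑ z ∈ periodBox (d := d) N, nhsNormSq (q z) := by rw [hCg]; ring
  have hv₀_lap : ∑ y ∈ periodBox (d := d) (N * L ^ (j + 1)), nhsNormSq (covLapSite W v₀ y)
      ≤ ϑ * (Cg * ∑ z ∈ periodBox (d := d) N, nhsNormSq (q z)) := by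
    rw [hv₀, ← covDiv_gaugeDir_eq_covLapSite]
    calc ∑ y ∈ periodBox (d := d) (N * L ^ (j + 1)), nhsNormSq (covDiv W (gaugeDir W (cutLow W (N * L ^ (j + 1)) ϑ (F p))) y)
        ≤ ϑ * ∑ y ∈ periodBox (d := d) (N * L ^ (j + 1)), ∑ κ : Fin d, nhsNormSq (gaugeDir W (F p) y κ) :=
          sum_nhsNormSq_covDiv_gaugeDir_cutLow_le hWu hP1 hWP hϑpos.le hwP
      _ ≤ ϑ * (2 * Φ * (Fintype.card n : ℝ) * ∑ z ∈ periodBox (d := d) N, nhsNormSq (p z)) :=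
          mul_le_mul_of_nonneg_left (hF_energy' p) hϑpos.le
      _ ≤ ϑ * (2 * Φ * (Fintype.card n : ℝ) * (4 * ∑ z ∈ periodBox (d := d) N, nhsNormSq (q z))) :=
          mul_le_mul_of_nonneg_left (mul_le_mul_of_nonneg_left hp_bd (by positivity)) hϑpos.le
      _ = ϑ * (Cg * ∑ z ∈ periodBox (d := d) N, nhsNormSq (q z)) := by rw [hCg]; ring
  refine ⟨fun y => (1 / 2 : ℝ) • (v₀ y - (v₀ y)ᴴ), fun y => half_sub_ct_mem _, fun y i => by simp only [hv₀P y i], ?_, ?_, ?_⟩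
  · -- nested means
    funext z
    have hsplit : (fun y => (1 / 2 : ℝ) • (v₀ y - (v₀ y)ᴴ)) = fun y => (1 / 2 : ℝ) • (v₀ y + (-1 : ℝ) • (v₀ y)ᴴ) := by
      funext y; rw [neg_one_smul, sub_eq_add_neg]
    rw [hsplit, bmeanIterW_smul_fun, bmeanIterW_add_fun, bmeanIterW_smul_fun, bmeanIterW_conjTranspose hL1 j hWu hx hsm hWx,
      hv₀_mean z, neg_one_smul, ← sub_eq_add_neg]
    exact half_sub_ct_of_skew (hqs z)
  · -- gradient
    have hpt : ∀ (y : Site d) (κ : Fin d), gaugeDir W (fun y => (1 / 2 : ℝ) • (v₀ y - (v₀ y)ᴴ)) y κ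
        = (1 / 2 : ℝ) • (gaugeDir W v₀ y κ - (gaugeDir W v₀ y κ)ᴴ) := by
      intro y κ
      have h1 : (fun y => (1 / 2 : ℝ) • (v₀ y - (v₀ y)ᴴ)) = fun y => (1 / 2 : ℝ) • (v₀ y + -(v₀ y)ᴴ) := by
        funext y; rw [sub_eq_add_neg]
      rw [h1, NE3HilbertSchmidtTorus.gaugeDir_smul_fun, NE3HilbertSchmidtTorus.gaugeDir_add_fun, gaugeDir_neg_conjTranspose hWu,
        ← sub_eq_add_neg]
    calc _ ≤ ∑ y ∈ periodBox (d := d) (N * L ^ (j + 1)), ∑ κ : Fin d, nhsNormSq (gaugeDir W v₀ y κ) :=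
          sum_le_sum fun y _ => sum_le_sum fun κ _ => by rw [hpt]; exact nhsNormSq_half_sub_ct_le _
      _ ≤ Cg * ∑ z ∈ periodBox (d := d) N, nhsNormSq (q z) := hv₀_grad
      _ = _ := by rw [hCg, hΦ]
  · -- Laplacian
    have hpt : ∀ y : Site d, covLapSite W (fun y => (1 / 2 : ℝ) • (v₀ y - (v₀ y)ᴴ)) y
        = (1 / 2 : ℝ) • (covLapSite W v₀ y - (covLapSite W v₀ y)ᴴ) := by
      intro y
      have h1 : (fun y => (1 / 2 : ℝ) • (v₀ y - (v₀ y)ᴴ)) = fun y => (1 / 2 : ℝ) • (v₀ y + -(v₀ y)ᴴ) := by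
        funext y; rw [sub_eq_add_neg]
      rw [h1, covLapSite_smul_fun, covLapSite_add_fun, covLapSite_neg_conjTranspose hWu, ← sub_eq_add_neg]
    calc _ ≤ ∑ y ∈ periodBox (d := d) (N * L ^ (j + 1)), nhsNormSq (covLapSite W v₀ y) :=
          sum_le_sum fun y _ => by rw [hpt]; exact nhsNormSq_half_sub_ct_le _
      _ ≤ ϑ * (Cg * ∑ z ∈ periodBox (d := d) N, nhsNormSq (q z)) := hv₀_lap
      _ = _ := by rw [hϑ, hCg, hΦ]

end

end Summit.QuantumFields.BalabanUV.T4Continuum.NE3.NestedMeanSmoothInterpolant
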